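import Literature.MathematicalPhysics.PowerSystems.KronReductionClosure
import HarnessLib

/-!
# Kron reduction under an interior edge perturbation: the rank-one update formula
# (Dörfler–Bullo 2013, Theorem 3.15 1)) — a line upgrade or outage between two buses changes the
# network-reduced model by an explicit rank-one term

Topic `Literature/MathematicalPhysics/PowerSystems`; namespaces `…PowerSystems.KronReduction` (§1
block form, §2 predicate form) and `…PowerSystems.ClassicalModel` (§3).  Eighth file of the
Dörfler–Bullo Kron-reduction story (`KronReductionClosure` supplies `interiorBlock_posDef_of_laplacian`).
Everything below is PROVED: 0 definitions, 0 named facts, 0 `sorry`, no new axiom.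

SOURCE (read on the page; `lit read paper:arxiv-1102.2950` = [DorflerBullo2013], F. Dörfler,
F. Bullo, *Kron reduction of graphs with applications to electrical networks*, IEEE TCAS-I 60 (2013)
150–163; labels of the held arXiv text):
* §3.2 Lemma 3.8 (p0015 L22–L30), the Sherman–Morrison formula.
* §3.4 Theorem 3.15 (Perturbation of the Interior Nodes) 1) (p0019 L95–L100, p0020 L1–L13): «Consider
  … the symmetric rank one perturbation `W = Δ (e_{i+|α|} − e_{j+|α|})(e_{i+|α|} − e_{j+|α|})ᵀ` … such
  that `Q̃ = Q + W` remains an irreducible loopy Laplacian … 1) Algebraic perturbation: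
  `Q̃_red = Q_red + Q_ac (e_i − e_j) Δ (e_i − e_j)ᵀ Q_acᵀ / (1 + Δ·R_int[i,j])`, where
  `R_int[i,j] = (e_i − e_j)ᵀ Q(α,α)⁻¹ (e_i − e_j) ≥ 0`»; proof (p0020 L40–L46): Sherman–Morrison in
  `Q̃_red = Q[α,α] − Q[α,α) (Q(α,α) + (e_i − e_j)Δ(e_i − e_j)ᵀ)⁻¹ Q(α,α]`; discussion (p0020
  L18–L24): «the perturbation of the interior edge `{i,j}` by a value `Δ` is equivalent to injecting
  the current `Δ·(V_i − V_j)` … In the reduced network equations the current injection translates to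
  the current injection `Q_ac Ĩ(α)` into the boundary nodes».
* §2.6 (p0010 L17): network-reduced model `P_ij = |V_i||V_j| Im(Q_red[i,j])`.

RENDERING.  Block form `[[A, B],[Bᵀ, C]]`, `C ≻ 0`, perturbation `C + Δ v vᵀ` (`Matrix.vecMulVec`);
`Q_ac = −BC⁻¹`, so the source's `Q_ac v (Q_ac v)ᵀ` is written `(BC⁻¹v)(BC⁻¹v)ᵀ`.  Predicate form:
`Q : Matrix ι ι ℝ`, boundary `{i // p i}`, the perturbing vector `w : ι → ℝ` supported in the
interior (for the edge `{i, j}`: `w = Pi.single i 1 − Pi.single j 1`), `Q_red` spelled out as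
`Q_αα − Q_αβ Q_ββ⁻¹ Q_βα`.  The non-degeneracy hypothesis is `1 + Δρ ≠ 0`, `ρ = w_βᵀQ_ββ⁻¹w_β`
(automatic for `Δ ≥ 0`; for an outage `Δ < 0` it says the perturbed interior block stays nonsingular).

WHAT IS PROVED (0 `def`, 0 named facts, 0 `sorry`):
* §1 ★ `inv_add_smul_vecMulVec` (Sherman–Morrison for `C ≻ 0`), ★★★ **`schur_add_rankOne_eq`**
  (Theorem 3.15 1), block form), `one_add_mul_interiorResistance_pos` (`Δ ≥ 0 ⇒ 1 + Δρ > 0`).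
* §2 ★★★ **`kronReduced_add_rankOne_eq`** (predicate form: `(Q + Δwwᵀ)_red = Q_red +
  (Δ/(1+Δρ))·g gᵀ`, `g = Q_αβQ_ββ⁻¹w_β = −Q_ac w_β`), ★★ `kronReduced_add_rankOne_apply` (entrywise;
  rows `a` with `g_a = 0` are unchanged).
* §3 THE MODEL (`ClassicalModel`; lossless network, susceptance loopy Laplacian `B` of a connected
  graph, generators = boundary): ★★★ **`kronCoupling_line_update`** — changing the susceptance of the
  line between two BUSES `i, j` by `Δ` changes every network-reduced coupling
  `|V_a||V_a'|(−B_red[a,a'])` by `−|V_a||V_a'|·(Δ/(1 + Δ R_int[i,j]))·g_a g_a'`,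
  `g_a = B_ac[a,j] − B_ac[a,i]` (N−1 / line-upgrade update of the reduced model is RANK ONE; a
  generator dividing its current equally between the line's ends keeps all its couplings); ★★
  `one_add_mul_busReactance_pos` (upgrades never degenerate).

PROOF ROUTE (the source's): Sherman–Morrison `(C + Δvvᵀ)⁻¹ = C⁻¹ − (Δ/(1+Δρ)) (C⁻¹v)(C⁻¹v)ᵀ`
checked by right multiplication (`Matrix.inv_eq_right_inv`, `Matrix.mul_vecMulVec`,
`Matrix.vecMulVec_mul_vecMulVec`), then expansion of `B(·)Bᵀ`.  In-seat exact cross-check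
(`negtest/kron_rankone_check.py`, python `Fraction`s, seat folder): 300 random connected loopy
Laplacians, random boundaries, interior edges and `Δ` of both signs — Sherman–Morrison, the rank-one
update, `g = B_ac[·,j] − B_ac[·,i]`, `1 + Δρ > 0` for `Δ ≥ 0`, unchanged rows when `g_a = 0`
(1 719 checks, 265 zero rows) all pass.

THREE COLUMNS.  CERTIFIED (kernel theorems): for exact symmetric `Q` with `Q_ββ ≻ 0`, interior-
supported `w` and `1 + Δ·w_βᵀQ_ββ⁻¹w_β ≠ 0`, `(Q + Δwwᵀ)/Q̃_ββ = Q/Q_ββ + (Δ/(1+Δρ))·ggᵀ`,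
`g = Q_αβQ_ββ⁻¹w_β`.  MODELLED: lossless network, classical machines as boundary nodes, constant
`|V|`; the update is an identity between the two reduced models, no dynamics.  NOT CLAIMED: Theorem
3.15 2) (resistive perturbation formula via `Q†`; its SIGN statement is Rayleigh, cf.
`KronReductionEffectiveResistance`), the spectral bounds after (3.15), several simultaneous edges
(iterate), lossy networks.

## References
* [DorflerBullo2013] F. Dörfler, F. Bullo, *Kron reduction of graphs with applications to electrical
  networks*, IEEE Trans. Circuits Syst. I 60 (2013) 150–163, arXiv:1102.2950 — §3.2 Lemma 3.8, §3.4
  Theorem 3.15 1), §2.6.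
* [HornJohnson2013] R. A. Horn, C. R. Johnson, *Matrix Analysis*, 2nd ed., CUP 2013 — §0.7.4
  (Sherman–Morrison–Woodbury).
-/

noncomputable section

open scoped Matrix
open Finset Matrix

namespace Literature.MathematicalPhysics.PowerSystems

namespace KronReduction

/-! ### §1. Block form: Sherman–Morrison and the rank-one update of the Schur complement
(Theorem 3.15 1)) -/

section RankOne

variable {m k : Type*} [Fintype m] [Fintype k] [DecidableEq m] [DecidableEq k]

omit [Fintype m] [DecidableEq m] in
/-- ★ **SHERMAN–MORRISON for a symmetric positive definite `C`**: with `u = C⁻¹v`,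
`ρ = vᵀC⁻¹v` and `1 + Δρ ≠ 0`, `(C + Δ v vᵀ)⁻¹ = C⁻¹ − (Δ/(1 + Δρ)) u uᵀ`.
[cite: DorflerBullo2013, §3.2 Lemma 3.8 (Sherman–Morrison formula) (arXiv:1102.2950 p0015 L22–L30); HornJohnson2013, §0.7.4 (Sherman–Morrison–Woodbury)] -/
theorem inv_add_smul_vecMulVec {C : Matrix k k ℝ} (hC : C.PosDef) (v : k → ℝ) {Δ : ℝ}
    (hΔ : 1 + Δ * (v ⬝ᵥ C⁻¹ *ᵥ v) ≠ 0) :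
    (C + Δ • Matrix.vecMulVec v v)⁻¹
      = C⁻¹ - (Δ / (1 + Δ * (v ⬝ᵥ C⁻¹ *ᵥ v))) • Matrix.vecMulVec (C⁻¹ *ᵥ v) (C⁻¹ *ᵥ v) := by
  have hCu : IsUnit C.det := (Matrix.isUnit_iff_isUnit_det _).1 hC.isUnit
  have hCt : C⁻¹ᵀ = C⁻¹ := by
    have h := hC.isHermitian.inv
    simpa only [Matrix.conjTranspose_eq_transpose_of_trivial] using h.eq
  set u := C⁻¹ *ᵥ v with hu
  set ρ := v ⬝ᵥ C⁻¹ *ᵥ v with hρ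
  set c := Δ / (1 + Δ * ρ) with hc
  have hCu' : C *ᵥ u = v := by rw [hu, Matrix.mulVec_mulVec, Matrix.mul_nonsing_inv _ hCu, Matrix.one_mulVec]
  have hvC : v ᵥ* C⁻¹ = u := by rw [hu, ← Matrix.mulVec_transpose, hCt]
  have hvu : v ⬝ᵥ u = ρ := by rw [hu, hρ]
  apply Matrix.inv_eq_right_inv
  rw [Matrix.add_mul, Matrix.mul_sub, Matrix.mul_sub, Matrix.mul_nonsing_inv _ hCu, Matrix.mul_smul,
    Matrix.mul_vecMulVec, hCu', Matrix.smul_mul, Matrix.vecMulVec_mul, hvC, Matrix.smul_mul,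
    Matrix.mul_smul, Matrix.vecMulVec_mul_vecMulVec, hvu]
  ext i j
  simp only [Matrix.sub_apply, Matrix.add_apply, Matrix.smul_apply, Matrix.vecMulVec_apply,
    Pi.smul_apply, smul_eq_mul, Matrix.one_apply]
  have key : -c + Δ - Δ * (c * ρ) = 0 := by
    rw [hc]; field_simp; ring
  have : -(c * (v i * u j)) + (Δ * (v i * u j) - Δ * (c * (v i * (ρ * u j))))
      = (-c + Δ - Δ * (c * ρ)) * (v i * u j) := by ring
  split_ifs <;> linear_combination (v i * u j) * key

omit [Fintype m] [DecidableEq m] in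
/-- ★★★ **THEOREM 3.15 1) ALGEBRAIC PERTURBATION, block form**: a symmetric rank-one perturbation
`Δ v vᵀ` supported in the interior changes the Schur complement by the rank-one matrix
`(Δ/(1 + Δ R_int)) (BC⁻¹v)(BC⁻¹v)ᵀ` with `R_int = vᵀC⁻¹v` («`Q̃_red = Q_red +
Q_ac (e_i − e_j) Δ (e_i − e_j)ᵀ Q_acᵀ / (1 + Δ·R_int[i,j])`, `R_int[i,j] = (e_i − e_j)ᵀ Q(α,α)⁻¹
(e_i − e_j)`»; `Q_ac = −BC⁻¹`, so `Q_ac v (Q_ac v)ᵀ = (BC⁻¹v)(BC⁻¹v)ᵀ`).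
[cite: DorflerBullo2013, §3.4 Theorem 3.15 1) eq. (algebraic perturbation) (arXiv:1102.2950 p0020 L1–L13); Lemma 3.8 (p0015 L22–L30)] -/
theorem schur_add_rankOne_eq (A : Matrix m m ℝ) (B : Matrix m k ℝ) {C : Matrix k k ℝ}
    (hC : C.PosDef) (v : k → ℝ) {Δ : ℝ} (hΔ : 1 + Δ * (v ⬝ᵥ C⁻¹ *ᵥ v) ≠ 0) :
    A - B * (C + Δ • Matrix.vecMulVec v v)⁻¹ * Bᵀ
      = (A - B * C⁻¹ * Bᵀ)
        + (Δ / (1 + Δ * (v ⬝ᵥ C⁻¹ *ᵥ v)))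
          • Matrix.vecMulVec (B *ᵥ (C⁻¹ *ᵥ v)) (B *ᵥ (C⁻¹ *ᵥ v)) := by
  rw [inv_add_smul_vecMulVec hC v hΔ, Matrix.mul_sub, Matrix.sub_mul, Matrix.mul_smul,
    Matrix.smul_mul, Matrix.mul_vecMulVec, Matrix.vecMulVec_mul, Matrix.vecMul_transpose]
  abel

omit [Fintype m] [DecidableEq m] in
/-- For `Δ ≥ 0` the denominator is positive: `1 + Δ·vᵀC⁻¹v > 0` (`C⁻¹ ≻ 0`). [cite: DorflerBullo2013, §3.4 Theorem 3.15 1) («`R_int[i,j] ≥ 0`») (arXiv:1102.2950 p0020 L13)] -/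
theorem one_add_mul_interiorResistance_pos {C : Matrix k k ℝ} (hC : C.PosDef) (v : k → ℝ)
    {Δ : ℝ} (hΔ : 0 ≤ Δ) : 0 < 1 + Δ * (v ⬝ᵥ C⁻¹ *ᵥ v) := by
  have h := hC.inv.posSemidef.dotProduct_mulVec_nonneg v
  simp only [star_trivial] at h
  have : 0 ≤ Δ * (v ⬝ᵥ C⁻¹ *ᵥ v) := mul_nonneg hΔ h
  linarith

end RankOne

/-! ### §2. Predicate form: perturbing an interior edge `{i, j}` of `Q` by `Δ` -/

section Predicate

variable {ι : Type*} [Fintype ι] [DecidableEq ι]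

omit [Fintype ι] [DecidableEq ι] in
/-- Symmetric entries. [folklore] -/
private theorem entry_symm₆ {Q : Matrix ι ι ℝ} (hQ : Q.IsHermitian) (i j : ι) : Q j i = Q i j := by
  simpa only [star_trivial] using hQ.apply i j

omit [Fintype ι] [DecidableEq ι] in
/-- The lower-left block is the transpose of the upper-right one. [folklore] -/
private theorem submatrix_swap_eq_transpose₆ (p : ι → Prop) {Q : Matrix ι ι ℝ}
    (hQ : Q.IsHermitian) : Q.submatrix (Subtype.val : {v : ι // ¬ (p v)} → ι) (Subtype.val : {v : ι // p v} → ι) = (Q.submatrix (Subtype.val : {v : ι // p v} → ι) (Subtype.val : {v : ι // ¬ (p v)} → ι))ᵀ := by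
  ext b a
  simp [entry_symm₆ hQ (a : ι) (b : ι)]

omit [Fintype ι] [DecidableEq ι] in
/-- Blocks of `Q + Δ·w wᵀ` for a vector `w` supported in the interior. [folklore] -/
private theorem blocks_add_rankOne (p : ι → Prop) (Q : Matrix ι ι ℝ) (Δ : ℝ) {w : ι → ℝ}
    (hw : ∀ a : {i // p i}, w a = 0) :
    (Q + Δ • Matrix.vecMulVec w w).submatrix (Subtype.val : {v : ι // p v} → ι) (Subtype.val : {v : ι // p v} → ι) = Q.submatrix (Subtype.val : {v : ι // p v} → ι) (Subtype.val : {v : ι // p v} → ι) ∧ (Q + Δ • Matrix.vecMulVec w w).submatrix (Subtype.val : {v : ι // p v} → ι) (Subtype.val : {v : ι // ¬ (p v)} → ι) = Q.submatrix (Subtype.val : {v : ι // p v} → ι) (Subtype.val : {v : ι // ¬ (p v)} → ι) ∧ (Q + Δ • Matrix.vecMulVec w w).submatrix (Subtype.val : {v : ι // ¬ (p v)} → ι) (Subtype.val : {v : ι // p v} → ι) = Q.submatrix (Subtype.val : {v : ι // ¬ (p v)} → ι) (Subtype.val : {v : ι // p v} → ι)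
    ∧ (Q + Δ • Matrix.vecMulVec w w).submatrix (Subtype.val : {v : ι // ¬ (p v)} → ι) (Subtype.val : {v : ι // ¬ (p v)} → ι) = Q.submatrix (Subtype.val : {v : ι // ¬ (p v)} → ι) (Subtype.val : {v : ι // ¬ (p v)} → ι) + Δ • Matrix.vecMulVec (fun b : {i // ¬ p i} => w b) (fun b : {i // ¬ p i} => w b) := by
  refine ⟨?_, ?_, ?_, ?_⟩
  · ext a a'; simp [Matrix.vecMulVec_apply, hw a]
  · ext a b; simp [Matrix.vecMulVec_apply, hw a]
  · ext b a; simp [Matrix.vecMulVec_apply, hw a]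
  · ext b b'; simp [Matrix.vecMulVec_apply]

/-- ★★★ **THEOREM 3.15 1), predicate form — THE RANK-ONE UPDATE OF A KRON REDUCTION UNDER AN
INTERIOR EDGE PERTURBATION**: `Q` symmetric with `Q_ββ ≻ 0`, `w` a vector supported in the interior
(for the edge `{i, j}`: `w = e_i − e_j`), `ρ = w_βᵀ Q_ββ⁻¹ w_β` (the «effective resistance between the
perturbed nodes in the interior network» when `w = e_i − e_j`) and `1 + Δρ ≠ 0`.  Then
`(Q + Δ w wᵀ)_red = Q_red + (Δ/(1 + Δρ))·g gᵀ` with `g = Q_αβ Q_ββ⁻¹ w_β = −Q_ac w_β`.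
[cite: DorflerBullo2013, §3.4 Theorem 3.15 1) with proof («The Sherman-Morrison formula … yields the algebraic perturbation») (arXiv:1102.2950 p0020 L1–L13, L40–L46)] -/
theorem kronReduced_add_rankOne_eq (p : ι → Prop) [DecidablePred p] {Q : Matrix ι ι ℝ}
    (hQ : Q.IsHermitian) (hC : (Q.submatrix (Subtype.val : {v : ι // ¬ (p v)} → ι) (Subtype.val : {v : ι // ¬ (p v)} → ι)).PosDef) {w : ι → ℝ} (hw : ∀ a : {i // p i}, w a = 0)
    {Δ : ℝ}
    (hΔ : 1 + Δ * ((fun b : {i // ¬ p i} => w b) ⬝ᵥ (Q.submatrix (Subtype.val : {v : ι // ¬ (p v)} → ι) (Subtype.val : {v : ι // ¬ (p v)} → ι))⁻¹ *ᵥ (fun b : {i // ¬ p i} => w b)) ≠ 0) :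
    ((Q + Δ • Matrix.vecMulVec w w).submatrix (Subtype.val : {v : ι // p v} → ι) (Subtype.val : {v : ι // p v} → ι)
        - (Q + Δ • Matrix.vecMulVec w w).submatrix (Subtype.val : {v : ι // p v} → ι) (Subtype.val : {v : ι // ¬ (p v)} → ι)
          * ((Q + Δ • Matrix.vecMulVec w w).submatrix (Subtype.val : {v : ι // ¬ (p v)} → ι) (Subtype.val : {v : ι // ¬ (p v)} → ι))⁻¹
          * (Q + Δ • Matrix.vecMulVec w w).submatrix (Subtype.val : {v : ι // ¬ (p v)} → ι) (Subtype.val : {v : ι // p v} → ι))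
      = (Q.submatrix (Subtype.val : {v : ι // p v} → ι) (Subtype.val : {v : ι // p v} → ι)
        - Q.submatrix (Subtype.val : {v : ι // p v} → ι) (Subtype.val : {v : ι // ¬ (p v)} → ι)
          * (Q.submatrix (Subtype.val : {v : ι // ¬ (p v)} → ι) (Subtype.val : {v : ι // ¬ (p v)} → ι))⁻¹
          * Q.submatrix (Subtype.val : {v : ι // ¬ (p v)} → ι) (Subtype.val : {v : ι // p v} → ι))
        + (Δ / (1 + Δ * ((fun b : {i // ¬ p i} => w b) ⬝ᵥ (Q.submatrix (Subtype.val : {v : ι // ¬ (p v)} → ι) (Subtype.val : {v : ι // ¬ (p v)} → ι))⁻¹ *ᵥ (fun b : {i // ¬ p i} => w b))))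
          • Matrix.vecMulVec (Q.submatrix (Subtype.val : {v : ι // p v} → ι) (Subtype.val : {v : ι // ¬ (p v)} → ι) *ᵥ ((Q.submatrix (Subtype.val : {v : ι // ¬ (p v)} → ι) (Subtype.val : {v : ι // ¬ (p v)} → ι))⁻¹ *ᵥ fun b : {i // ¬ p i} => w b))
              (Q.submatrix (Subtype.val : {v : ι // p v} → ι) (Subtype.val : {v : ι // ¬ (p v)} → ι) *ᵥ ((Q.submatrix (Subtype.val : {v : ι // ¬ (p v)} → ι) (Subtype.val : {v : ι // ¬ (p v)} → ι))⁻¹ *ᵥ fun b : {i // ¬ p i} => w b)) := by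
  obtain ⟨h1, h2, h3, h4⟩ := blocks_add_rankOne p Q Δ hw
  rw [h1, h2, h3, h4, submatrix_swap_eq_transpose₆ p hQ]
  exact schur_add_rankOne_eq _ _ hC _ hΔ

/-- ★★ **Generators not seeing the perturbed edge are unaffected; couplings change by
`−(Δ/(1+Δρ)) g_a g_a'`**: entrywise reading of the rank-one update — for boundary `a, a'`,
`(Q̃_red − Q_red)[a,a'] = (Δ/(1 + Δρ))·g_a g_a'`; in particular every entry of row `a` of the
reduction is unchanged when `g_a = 0`.
[cite: DorflerBullo2013, §3.4 Theorem 3.15 1) and the discussion after it («the perturbation of the interior edge … is equivalent to injecting the current `Δ(V_i − V_j)` … translates to the current injection `Q_ac Ĩ` into the boundary nodes») (arXiv:1102.2950 p0020 L1–L13, L40–L46)] -/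
theorem kronReduced_add_rankOne_apply (p : ι → Prop) [DecidablePred p] {Q : Matrix ι ι ℝ}
    (hQ : Q.IsHermitian) (hC : (Q.submatrix (Subtype.val : {v : ι // ¬ (p v)} → ι) (Subtype.val : {v : ι // ¬ (p v)} → ι)).PosDef) {w : ι → ℝ} (hw : ∀ a : {i // p i}, w a = 0)
    {Δ : ℝ}
    (hΔ : 1 + Δ * ((fun b : {i // ¬ p i} => w b) ⬝ᵥ (Q.submatrix (Subtype.val : {v : ι // ¬ (p v)} → ι) (Subtype.val : {v : ι // ¬ (p v)} → ι))⁻¹ *ᵥ (fun b : {i // ¬ p i} => w b)) ≠ 0)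
    (a a' : {i // p i}) :
    ((Q + Δ • Matrix.vecMulVec w w).submatrix (Subtype.val : {v : ι // p v} → ι) (Subtype.val : {v : ι // p v} → ι)
        - (Q + Δ • Matrix.vecMulVec w w).submatrix (Subtype.val : {v : ι // p v} → ι) (Subtype.val : {v : ι // ¬ (p v)} → ι)
          * ((Q + Δ • Matrix.vecMulVec w w).submatrix (Subtype.val : {v : ι // ¬ (p v)} → ι) (Subtype.val : {v : ι // ¬ (p v)} → ι))⁻¹
          * (Q + Δ • Matrix.vecMulVec w w).submatrix (Subtype.val : {v : ι // ¬ (p v)} → ι) (Subtype.val : {v : ι // p v} → ι)) a a' - (Q.submatrix (Subtype.val : {v : ι // p v} → ι) (Subtype.val : {v : ι // p v} → ι)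
        - Q.submatrix (Subtype.val : {v : ι // p v} → ι) (Subtype.val : {v : ι // ¬ (p v)} → ι)
          * (Q.submatrix (Subtype.val : {v : ι // ¬ (p v)} → ι) (Subtype.val : {v : ι // ¬ (p v)} → ι))⁻¹
          * Q.submatrix (Subtype.val : {v : ι // ¬ (p v)} → ι) (Subtype.val : {v : ι // p v} → ι)) a a'
      = (Δ / (1 + Δ * ((fun b : {i // ¬ p i} => w b) ⬝ᵥ (Q.submatrix (Subtype.val : {v : ι // ¬ (p v)} → ι) (Subtype.val : {v : ι // ¬ (p v)} → ι))⁻¹ *ᵥ (fun b : {i // ¬ p i} => w b))))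
        * ((Q.submatrix (Subtype.val : {v : ι // p v} → ι) (Subtype.val : {v : ι // ¬ (p v)} → ι) *ᵥ ((Q.submatrix (Subtype.val : {v : ι // ¬ (p v)} → ι) (Subtype.val : {v : ι // ¬ (p v)} → ι))⁻¹ *ᵥ fun b : {i // ¬ p i} => w b)) a
          * (Q.submatrix (Subtype.val : {v : ι // p v} → ι) (Subtype.val : {v : ι // ¬ (p v)} → ι) *ᵥ ((Q.submatrix (Subtype.val : {v : ι // ¬ (p v)} → ι) (Subtype.val : {v : ι // ¬ (p v)} → ι))⁻¹ *ᵥ fun b : {i // ¬ p i} => w b)) a') := by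
  rw [kronReduced_add_rankOne_eq p hQ hC hw hΔ, Matrix.add_apply, Matrix.smul_apply,
    Matrix.vecMulVec_apply, smul_eq_mul]
  ring

end Predicate

end KronReduction

/-! ### §3. THE MODEL: a line upgrade or outage between two buses updates the network-reduced
model by an explicit rank-one term -/

namespace ClassicalModel

open KronReduction

variable {ι : Type*} [Fintype ι] [DecidableEq ι]

/-- ★★★ **N−1 / LINE-UPGRADE UPDATE OF THE NETWORK-REDUCED MODEL IS RANK ONE.**  `B = −Im(Q)` the
susceptance loopy Laplacian of a connected lossless network (`hB hZ hrow hG hconn`), generators =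
boundary `α ≠ ∅`; change the susceptance of the line between two BUSES `i ≠ j` by `Δ`
(`B̃ = B + Δ(e_i − e_j)(e_i − e_j)ᵀ`: upgrade `Δ > 0`, partial or full outage `Δ < 0`) with
`1 + Δ·R_int[i,j] ≠ 0`, `R_int[i,j] = (e_i − e_j)ᵀ B(α,α)⁻¹ (e_i − e_j)` the effective reactance
between the two buses inside the bus network (automatic for `Δ ≥ 0`).  Then for all generators
`a, a'`:  `B̃_red[a,a'] − B_red[a,a'] = (Δ/(1 + Δ R_int[i,j]))·g_a g_a'` with
`g = B_αβ B_ββ⁻¹(e_i − e_j)` (`g_a = B_ac[a,j] − B_ac[a,i]`, the difference of generator `a`'s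
accompanying / current-division factors at the two buses): every coupling `|V_a||V_a'|(−B_red[a,a'])`
changes by `−|V_a||V_a'|(Δ/(1 + Δ R_int)) g_a g_a'`, and a generator that divides its current equally
between the two line ends (`g_a = 0`) keeps all its couplings.  CERTIFIED: kernel identity;
MODELLED: lossless, classical machines, constant `|V|`.
[cite: DorflerBullo2013, §3.4 Theorem 3.15 1) and discussion (arXiv:1102.2950 p0019 L95–L100, p0020 L1–L13, L40–L46); §2.6 (`P_ij = |V_i||V_j| Im(Q_red[i,j])`) (p0010 L17)] -/
theorem kronCoupling_line_update (p : ι → Prop) [DecidablePred p] {B : Matrix ι ι ℝ}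
    (hB : B.IsHermitian) (hZ : ∀ i j, i ≠ j → B i j ≤ 0) (hrow : ∀ i, 0 ≤ ∑ j, B i j)
    {G : SimpleGraph ι} (hG : ∀ i j, G.Adj i j ↔ i ≠ j ∧ B i j ≠ 0) (hconn : G.Connected)
    (hα : ∃ i, p i) {i j : ι} (hi : ¬ p i) (hj : ¬ p j) {Δ : ℝ}
    (hΔ : 1 + Δ * ((fun b : {v // ¬ p v} => (Pi.single i (1 : ℝ) - Pi.single j (1 : ℝ) : ι → ℝ) b)
      ⬝ᵥ (B.submatrix (Subtype.val : {v : ι // ¬ (p v)} → ι) (Subtype.val : {v : ι // ¬ (p v)} → ι))⁻¹ *ᵥ (fun b : {v // ¬ p v} => (Pi.single i (1 : ℝ) - Pi.single j (1 : ℝ) : ι → ℝ) b)) ≠ 0)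
    (V : ι → ℝ) (a a' : {v // p v}) :
    V a * V a' * -(((B + Δ • Matrix.vecMulVec (Pi.single i (1 : ℝ) - Pi.single j (1 : ℝ) : ι → ℝ) (Pi.single i (1 : ℝ) - Pi.single j (1 : ℝ) : ι → ℝ)).submatrix (Subtype.val : {v : ι // p v} → ι) (Subtype.val : {v : ι // p v} → ι)
        - (B + Δ • Matrix.vecMulVec (Pi.single i (1 : ℝ) - Pi.single j (1 : ℝ) : ι → ℝ) (Pi.single i (1 : ℝ) - Pi.single j (1 : ℝ) : ι → ℝ)).submatrix (Subtype.val : {v : ι // p v} → ι) (Subtype.val : {v : ι // ¬ (p v)} → ι)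
          * ((B + Δ • Matrix.vecMulVec (Pi.single i (1 : ℝ) - Pi.single j (1 : ℝ) : ι → ℝ) (Pi.single i (1 : ℝ) - Pi.single j (1 : ℝ) : ι → ℝ)).submatrix (Subtype.val : {v : ι // ¬ (p v)} → ι) (Subtype.val : {v : ι // ¬ (p v)} → ι))⁻¹
          * (B + Δ • Matrix.vecMulVec (Pi.single i (1 : ℝ) - Pi.single j (1 : ℝ) : ι → ℝ) (Pi.single i (1 : ℝ) - Pi.single j (1 : ℝ) : ι → ℝ)).submatrix (Subtype.val : {v : ι // ¬ (p v)} → ι) (Subtype.val : {v : ι // p v} → ι)) a a') - V a * V a' * -((B.submatrix (Subtype.val : {v : ι // p v} → ι) (Subtype.val : {v : ι // p v} → ι)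
        - B.submatrix (Subtype.val : {v : ι // p v} → ι) (Subtype.val : {v : ι // ¬ (p v)} → ι)
          * (B.submatrix (Subtype.val : {v : ι // ¬ (p v)} → ι) (Subtype.val : {v : ι // ¬ (p v)} → ι))⁻¹
          * B.submatrix (Subtype.val : {v : ι // ¬ (p v)} → ι) (Subtype.val : {v : ι // p v} → ι)) a a')
      = -(V a * V a')
        * ((Δ / (1 + Δ * ((fun b : {v // ¬ p v} => (Pi.single i (1 : ℝ) - Pi.single j (1 : ℝ) : ι → ℝ) b)
              ⬝ᵥ (B.submatrix (Subtype.val : {v : ι // ¬ (p v)} → ι) (Subtype.val : {v : ι // ¬ (p v)} → ι))⁻¹ *ᵥ (fun b : {v // ¬ p v} => (Pi.single i (1 : ℝ) - Pi.single j (1 : ℝ) : ι → ℝ) b))))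
          * ((B.submatrix (Subtype.val : {v : ι // p v} → ι) (Subtype.val : {v : ι // ¬ (p v)} → ι) *ᵥ ((B.submatrix (Subtype.val : {v : ι // ¬ (p v)} → ι) (Subtype.val : {v : ι // ¬ (p v)} → ι))⁻¹ *ᵥ fun b : {v // ¬ p v} => (Pi.single i (1 : ℝ) - Pi.single j (1 : ℝ) : ι → ℝ) b)) a
            * (B.submatrix (Subtype.val : {v : ι // p v} → ι) (Subtype.val : {v : ι // ¬ (p v)} → ι) *ᵥ ((B.submatrix (Subtype.val : {v : ι // ¬ (p v)} → ι) (Subtype.val : {v : ι // ¬ (p v)} → ι))⁻¹ *ᵥ fun b : {v // ¬ p v} => (Pi.single i (1 : ℝ) - Pi.single j (1 : ℝ) : ι → ℝ) b)) a')) := by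
  have hC := interiorBlock_posDef_of_laplacian p hB hZ hrow hG hconn hα
  have hw : ∀ a : {v // p v}, (Pi.single i (1 : ℝ) - Pi.single j (1 : ℝ) : ι → ℝ) a = 0 := by
    intro a
    have hai : (a : ι) ≠ i := fun h => hi (h ▸ a.2)
    have haj : (a : ι) ≠ j := fun h => hj (h ▸ a.2)
    rw [Pi.sub_apply, Pi.single_eq_of_ne hai, Pi.single_eq_of_ne haj, sub_zero]
  have h := kronReduced_add_rankOne_apply p hB hC hw hΔ a a'
  linear_combination (-(V a * V a')) * h

/-- ★★ **For an upgrade (`Δ ≥ 0`) the denominator is automatically positive** (`R_int ≥ 0`).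
[cite: DorflerBullo2013, §3.4 Theorem 3.15 1) («`R_int[i,j] ≥ 0`») (arXiv:1102.2950 p0020 L13)] -/
theorem one_add_mul_busReactance_pos (p : ι → Prop) [DecidablePred p] {B : Matrix ι ι ℝ}
    (hB : B.IsHermitian) (hZ : ∀ i j, i ≠ j → B i j ≤ 0) (hrow : ∀ i, 0 ≤ ∑ j, B i j)
    {G : SimpleGraph ι} (hG : ∀ i j, G.Adj i j ↔ i ≠ j ∧ B i j ≠ 0) (hconn : G.Connected)
    (hα : ∃ i, p i) (u : {v // ¬ p v} → ℝ) {Δ : ℝ} (hΔ : 0 ≤ Δ) :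
    0 < 1 + Δ * (u ⬝ᵥ (B.submatrix (Subtype.val : {v : ι // ¬ (p v)} → ι) (Subtype.val : {v : ι // ¬ (p v)} → ι))⁻¹ *ᵥ u) :=
  one_add_mul_interiorResistance_pos (interiorBlock_posDef_of_laplacian p hB hZ hrow hG hconn hα) u hΔ

end ClassicalModel

end Literature.MathematicalPhysics.PowerSystems
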